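import Summits.NavierStokesRegularity.FluidComputer.PalasekTowerLiveClassAt
import Literature.Analysis.FluidPDE.HelicityDensityPseudoscalar

/-!
# REGISTER v2.3′ AT ARBITRARY RATES, V: the HELICITY RIDER for the live-class vocabulary —
# `(∃ x, ⟪v x, curl v x⟫ ≠ 0) → ¬ DeadSlice v`, placement invariance of `DeadSlice`, and the
# stage-level certificate `liveStageAt_of_inner_self_curl_ne_zero`

Cell `ns-blowup`, seat `ns-blowup-fc-prover-2` (g10). DIRECTOR-NS g8 #48 (3)(b) / #52 (3) asked for the
live-class vocabulary `PalasekTowerLiveClassAt.lean` (g9, landed) "WITH the helicity rider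
`(∃ x, ⟪v x, curl v x⟫ ≠ 0) → ¬ DeadSlice v`"; g9 left the rider open ("needs curl covariance under a
general linear isometry"). That covariance is the tree's `curl_conj_linearIsometryEquiv`
(`Literature/…/CurlIsometryCovariance.lean`, `det R = ±1`); the Literature companion
`HelicityDensityPseudoscalar.lean` turns it into: the helicity density `⟪v, curl v⟫` is a PSEUDOSCALAR
under rigid motions and VANISHES IDENTICALLY for `C¹` axisymmetric swirl-free fields. This file is the
≤ 10-line glue over the g9 names `conjSlice` / `DeadSlice` / `LiveStageAt`:

* §1 `conjSlice A b v` IS the rigid motion `y ↦ R (v (R⁻¹ y + b))` with `R = A⁻¹`: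
  `curl_conjSlice` (`curl (conjSlice A b v) x = det A⁻¹ • A⁻¹ (curl v (A x + b))`),
  `inner_self_curl_conjSlice` (helicity density `= det A⁻¹ · ⟪v, curl v⟫ (A x + b)`),
  `contDiff_conjSlice`; `conjSlice_conjSlice` (placements compose) and
  **`deadSlice_conjSlice_iff : DeadSlice (conjSlice A b v) ↔ DeadSlice v`** — deadness / liveness is
  a property of the slice, not of the laboratory frame.
* §2 **`DeadSlice.inner_self_curl_eq_zero`**: a dead `C¹` slice has helicity density `≡ 0`; hence the
  RIDER **`not_deadSlice_of_inner_self_curl_ne_zero : ContDiff ℝ 1 v → ⟪v x, curl v x⟫ ≠ 0 → ¬ DeadSlice v`**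
  and its `∃`-form `not_deadSlice_of_exists_inner_self_curl_ne_zero` (the director's literal sentence,
  for `C¹` slices).
* §3 stage level: the readout slice `s.u (τ_k)` of a registered stage is smooth (classical solution on
  the closed slab), so **`liveStageAt_of_inner_self_curl_ne_zero`**: ONE point of non-zero helicity
  density at the hand-over time certifies `LiveStageAt R S s` — the form a LEAD's `stub_live` can be
  discharged in (Burgers/strained-tube children with swirl, ring pairs WITH swirl, oblique pairs all
  carry `v · ω ≠ 0` somewhere; a columnar pure-swirl vortex `u_θ(r) e_θ` does NOT — it is live but has
  `v · ω ≡ 0`, so the rider is sufficient, not necessary).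

LABEL: E–C typing glue (KERNEL). WHAT THIS IS NOT: not Navier–Stokes evidence — a sufficient
certificate that a GIVEN velocity slice is axisymmetric-swirl-free in NO rigid placement; no stage,
design, witness or tower is constructed, no item is asserted, restated or closed.

References: H. K. Moffatt, J. Fluid Mech. 35 (1969) §1 (helicity density, pseudoscalar)
[cite: Moffatt1969, §1]; A. J. Majda, A. L. Bertozzi, *Vorticity and Incompressible Flow* (2002)
§2.3.3 (2.53)–(2.54) (swirl-free axisymmetric: `v` poloidal, `ω = ω^θ e_θ`)
[cite: MajdaBertozziCUP2002, §2.3.3 (2.53)–(2.54)]; S. Palasek, arXiv:2605.13827 §4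
[cite: Palasek2026ElementaryModel, §4].
-/

noncomputable section

namespace Summit.NavierStokesRegularity.FluidComputer.PalasekTowerClayBridge

open Set
open Literature.Analysis.FluidPDE
open scoped InnerProductSpace RealInnerProductSpace ContDiff

variable {R : TowerRates}

/-! ## §1 `conjSlice` as a rigid motion: curl, helicity density, smoothness, composition -/

section ConjSlice

variable (A : EuclideanSpace ℝ (Fin 3) ≃ₗᵢ[ℝ] EuclideanSpace ℝ (Fin 3)) (b : EuclideanSpace ℝ (Fin 3))
  (v : EuclideanSpace ℝ (Fin 3) → EuclideanSpace ℝ (Fin 3))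

/-- **Curl of a rigidly placed slice**: `curl (conjSlice A b v) x = det A⁻¹ • A⁻¹ (curl v (A x + b))`
(`det A⁻¹ = ±1`; no differentiability hypothesis — the tree's `curl_conj_rigidMotion` with `R = A⁻¹`).
[cite: ArfkenWeber1995, §2.9 eq. (2.90), (2.97)–(2.99)] -/
theorem curl_conjSlice (x : EuclideanSpace ℝ (Fin 3)) :
    curl (conjSlice A b v) x =
      (A.symm : EuclideanSpace ℝ (Fin 3) →L[ℝ] EuclideanSpace ℝ (Fin 3)).det •
        A.symm (curl v (A x + b)) := by
  have h := curl_conj_rigidMotion A.symm b v x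
  simp only [LinearIsometryEquiv.symm_symm] at h
  exact h

/-- **Helicity density of a rigidly placed slice**:
`⟪conjSlice A b v x, curl (conjSlice A b v) x⟫ = det A⁻¹ · ⟪v (A x + b), curl v (A x + b)⟫`
(a pseudoscalar). [cite: Moffatt1969, §1] -/
theorem inner_self_curl_conjSlice (x : EuclideanSpace ℝ (Fin 3)) :
    ⟪conjSlice A b v x, curl (conjSlice A b v) x⟫ =
      (A.symm : EuclideanSpace ℝ (Fin 3) →L[ℝ] EuclideanSpace ℝ (Fin 3)).det *
        ⟪v (A x + b), curl v (A x + b)⟫ := by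
  have h := inner_self_curl_conj_rigidMotion A.symm b v x
  simp only [LinearIsometryEquiv.symm_symm] at h
  exact h

/-- The helicity density of a rigidly placed slice vanishes at `x` iff that of the slice vanishes at
`A x + b`. [cite: Moffatt1969, §1] -/
theorem inner_self_curl_conjSlice_eq_zero_iff (x : EuclideanSpace ℝ (Fin 3)) :
    ⟪conjSlice A b v x, curl (conjSlice A b v) x⟫ = 0 ↔ ⟪v (A x + b), curl v (A x + b)⟫ = 0 := by
  have h := inner_self_curl_conj_rigidMotion_eq_zero_iff A.symm b v x
  simp only [LinearIsometryEquiv.symm_symm] at h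
  exact h

variable {v} in
/-- A rigidly placed `Cⁿ` slice is `Cⁿ`. [folklore] -/
theorem contDiff_conjSlice {n : WithTop ℕ∞} (hv : ContDiff ℝ n v) : ContDiff ℝ n (conjSlice A b v) := by
  have h := hv.conj_rigidMotion A.symm b
  simp only [LinearIsometryEquiv.symm_symm] at h
  exact h

/-- **Placements compose**: placing `conjSlice A b v` by `(A', b')` is placing `v` by
`(A' ≫ A, A b' + b)`. [folklore] -/
theorem conjSlice_conjSlice (A' : EuclideanSpace ℝ (Fin 3) ≃ₗᵢ[ℝ] EuclideanSpace ℝ (Fin 3))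
    (b' : EuclideanSpace ℝ (Fin 3)) :
    conjSlice A' b' (conjSlice A b v) = conjSlice (A'.trans A) (A b' + b) v := by
  funext x
  simp only [conjSlice, LinearIsometryEquiv.symm_trans, LinearIsometryEquiv.trans_apply, map_add,
    add_assoc]

/-- **`DeadSlice` is placement invariant**: a rigidly placed slice is dead iff the slice is — so
`LiveStageAt` does not depend on the laboratory frame. [folklore] -/
theorem deadSlice_conjSlice_iff : DeadSlice (conjSlice A b v) ↔ DeadSlice v := by
  constructor
  · rintro ⟨A', b', hax, hsw⟩
    rw [conjSlice_conjSlice] at hax hsw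
    exact ⟨A'.trans A, A b' + b, hax, hsw⟩
  · rintro ⟨A', b', hax, hsw⟩
    have hAA : (A'.trans A.symm).trans A = A' := by
      rw [← LinearIsometryEquiv.trans_assoc, LinearIsometryEquiv.symm_trans_self,
        LinearIsometryEquiv.trans_refl]
    have hbb : A (A.symm (b' - b)) + b = b' := by simp
    refine ⟨A'.trans A.symm, A.symm (b' - b), ?_, ?_⟩
    · rwa [conjSlice_conjSlice, hAA, hbb]
    · rwa [conjSlice_conjSlice, hAA, hbb]

end ConjSlice

/-! ## §2 Dead slices have zero helicity density: the RIDER -/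

section Rider

variable {v : EuclideanSpace ℝ (Fin 3) → EuclideanSpace ℝ (Fin 3)}

/-- **A dead `C¹` slice has helicity density `≡ 0`**: in the dead placement the slice is poloidal and
its vorticity toroidal (`inner_self_curl_eq_zero_of_isAxisymmetric`), and the helicity density is a
pseudoscalar under the placement. [cite: MajdaBertozziCUP2002, §2.3.3 (2.53)–(2.54)] -/
theorem DeadSlice.inner_self_curl_eq_zero (hdead : DeadSlice v) (hv : ContDiff ℝ 1 v)
    (x : EuclideanSpace ℝ (Fin 3)) : ⟪v x, curl v x⟫ = 0 := by
  obtain ⟨A, b, hax, hsw⟩ := hdead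
  have h := inner_self_curl_eq_zero_of_conj_rigidMotion (v := v) A.symm b hv
  simp only [LinearIsometryEquiv.symm_symm] at h
  exact h hax hsw x

/-- **THE HELICITY RIDER** (DIRECTOR-NS g8 #48 (3)(b)): a `C¹` slice with non-zero helicity density at
ONE point is not dead — it is axisymmetric-swirl-free in NO rigid placement.
[cite: MajdaBertozziCUP2002, §2.3.3 (2.53)–(2.54)] -/
theorem not_deadSlice_of_inner_self_curl_ne_zero (hv : ContDiff ℝ 1 v) {x : EuclideanSpace ℝ (Fin 3)}
    (hx : ⟪v x, curl v x⟫ ≠ 0) : ¬ DeadSlice v :=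
  fun hdead => hx (hdead.inner_self_curl_eq_zero hv x)

/-- The rider, `∃`-form (the director's sentence, for `C¹` slices):
`(∃ x, ⟪v x, curl v x⟫ ≠ 0) → ¬ DeadSlice v`. [cite: MajdaBertozziCUP2002, §2.3.3 (2.53)–(2.54)] -/
theorem not_deadSlice_of_exists_inner_self_curl_ne_zero (hv : ContDiff ℝ 1 v)
    (h : ∃ x, ⟪v x, curl v x⟫ ≠ 0) : ¬ DeadSlice v := by
  obtain ⟨x, hx⟩ := h
  exact not_deadSlice_of_inner_self_curl_ne_zero hv hx

/-- Contrapositive bookkeeping: a dead `C¹` slice has no point of non-zero helicity density.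
[cite: MajdaBertozziCUP2002, §2.3.3 (2.53)–(2.54)] -/
theorem DeadSlice.not_exists_inner_self_curl_ne_zero (hdead : DeadSlice v) (hv : ContDiff ℝ 1 v) :
    ¬ ∃ x, ⟪v x, curl v x⟫ ≠ 0 :=
  fun h => not_deadSlice_of_exists_inner_self_curl_ne_zero hv h hdead

end Rider

/-! ## §3 Stage level: certifying `LiveStageAt R S s` -/

section StageLevel

variable (S : Schedule R) {k : ℕ} (s : Stage 1 R S (Margins.routeG R) k)

/-- The readout slice of a registered stage at its hand-over time `τ_k` is smooth (classical solution
on the closed slab `[0, τ_k]`). [folklore] -/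
theorem Stage.contDiff_readoutSlice : ContDiff ℝ ∞ (s.u (S.τ k)) :=
  s.classical.contDiff_velocity ⟨(S.τ_pos k).le, le_rfl⟩

/-- **Certifying liveness by helicity**: ONE point of non-zero helicity density of the readout slice
`s.u (τ_k)` makes the registered stage LIVE (`LiveStageAt R S s`) — the shape in which a line's
`stub_live` is discharged. [cite: Palasek2026ElementaryModel, §4] -/
theorem liveStageAt_of_inner_self_curl_ne_zero {x : EuclideanSpace ℝ (Fin 3)}
    (hx : ⟪s.u (S.τ k) x, curl (s.u (S.τ k)) x⟫ ≠ 0) : LiveStageAt R S s :=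
  not_deadSlice_of_inner_self_curl_ne_zero
    ((Stage.contDiff_readoutSlice S s).of_le (by norm_cast)) hx

/-- `∃`-form of the stage-level certificate. [cite: Palasek2026ElementaryModel, §4] -/
theorem liveStageAt_of_exists_inner_self_curl_ne_zero
    (h : ∃ x, ⟪s.u (S.τ k) x, curl (s.u (S.τ k)) x⟫ ≠ 0) : LiveStageAt R S s := by
  obtain ⟨x, hx⟩ := h
  exact liveStageAt_of_inner_self_curl_ne_zero S s hx

/-- Conversely, a stage that is NOT live (dead readout slice) has helicity density `≡ 0` at `τ_k`.
[cite: Palasek2026ElementaryModel, §4] -/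
theorem inner_self_curl_eq_zero_of_not_liveStageAt (h : ¬ LiveStageAt R S s)
    (x : EuclideanSpace ℝ (Fin 3)) : ⟪s.u (S.τ k) x, curl (s.u (S.τ k)) x⟫ = 0 :=
  DeadSlice.inner_self_curl_eq_zero (not_not.1 h)
    ((Stage.contDiff_readoutSlice S s).of_le (by norm_cast)) x

/-- Frame independence at stage level: the readout slice is live iff any rigid placement of it is.
[folklore] -/
theorem liveStageAt_iff_not_deadSlice_conjSlice
    (A : EuclideanSpace ℝ (Fin 3) ≃ₗᵢ[ℝ] EuclideanSpace ℝ (Fin 3)) (b : EuclideanSpace ℝ (Fin 3)) :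
    LiveStageAt R S s ↔ ¬ DeadSlice (conjSlice A b (s.u (S.τ k))) := by
  rw [deadSlice_conjSlice_iff]
  rfl

end StageLevel

end Summit.NavierStokesRegularity.FluidComputer.PalasekTowerClayBridge

end
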